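import Summits.Ventures.LatticeQCDFlow.Scoring.SU2TorusWilsonLoopsFiniteVolume
import HarnessLib

/-!
# An abstract two-series estimate for pair correlations: `|N/Z − (w_1/w_0)²| ≤ (w_1/w_0)^{v+1} (7/16 + (21/16)(Σ_n w_{n+1})/w_0)`

HONEST FRAMING: exact (Metropolis-corrected) sampling algorithms for lattice gauge theory;
figures of merit are autocorrelation/cost numbers at stated couplings and volumes; no
continuum-physics claim.

Venture `LatticeQCDFlow` (cell pub-lqcd), sub-topic `Scoring`; FANOUT row 5 (`s0-sun-a`), GEN-12.
NEW WORK of the cell (placement rule); the abstract half of the finite-volume analysis of the exact pair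
correlation of two distinct plaquettes (`SU2TorusPlaquettePairFiniteVolume`), in the pattern of GEN-11's
`SU2TorusWilsonLoopsFiniteVolume.abs_div_tsum_sub_pow_le`.  For an antitone, positive, summable `w : ℕ → ℝ`
and `v : ℕ`, with `Z = Σ_n w_n^{v+3}`,
`N = ¼ Σ_n [w_n² w_{n+1}^{v+1} ((n+1)/(n+2))² + 2 w_n w_{n+2} w_{n+1}^{v+1} (n+1)(n+3)/(n+2)² + w_{n+1}² w_n^{v+1} ((n+2)/(n+1))²]`,
`r = w_1/w_0`:

* `summable_pairNumTerm`; `abs_pairTailTerm_le` (each term of `N − r²Z` beyond the first has modulus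
  `≤ (21/16) w_1^{v+2} w_n`); **`abs_div_tsum_pair_sub_le`** `|N/Z − r²| ≤ r^{v+1} (7/16 + (21/16)(Σ_n w_{n+1})/w_0)`.

Elementary real analysis; nothing is cited; no `def`.
-/

noncomputable section

open Real MeasureTheory Set Function Finset Filter Topology Polynomial.Chebyshev
open Literature.MathematicalPhysics.QuantumFieldTheory Literature.MathematicalPhysics.QuantumLattice
open Literature.Analysis.FunctionSpaces
open Summit.Ventures.LatticeQCDFlow.Exactness
open Summit.Ventures.LatticeQCDFlow.Theory2.Lattice

namespace Summit.Ventures.LatticeQCDFlow.Scoring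

/-! ## §1. The abstract estimate -/

section Abstract

variable {w : ℕ → ℝ} (hanti : Antitone w) (hpos : ∀ n, 0 < w n) (hsum : Summable w)
include hanti hpos hsum

/-- The pair numerator terms are summable. -/
theorem summable_pairNumTerm (v : ℕ) :
    Summable fun n : ℕ => (1 / 4 : ℝ) * (w n ^ 2 * w (n + 1) ^ (v + 1) * (((n : ℝ) + 1) ^ 2 / ((n : ℝ) + 2) ^ 2) +
      2 * (w n * w (n + 2) * w (n + 1) ^ (v + 1)) * (((n : ℝ) + 1) * ((n : ℝ) + 3) / ((n : ℝ) + 2) ^ 2) +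
      w (n + 1) ^ 2 * w n ^ (v + 1) * (((n : ℝ) + 2) ^ 2 / ((n : ℝ) + 1) ^ 2)) := by
  have hb : ∀ n : ℕ, (1 / 4 : ℝ) * (w n ^ 2 * w (n + 1) ^ (v + 1) * (((n : ℝ) + 1) ^ 2 / ((n : ℝ) + 2) ^ 2) +
      2 * (w n * w (n + 2) * w (n + 1) ^ (v + 1)) * (((n : ℝ) + 1) * ((n : ℝ) + 3) / ((n : ℝ) + 2) ^ 2) +
      w (n + 1) ^ 2 * w n ^ (v + 1) * (((n : ℝ) + 2) ^ 2 / ((n : ℝ) + 1) ^ 2)) ≤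
      (1 / 4 : ℝ) * (w 0 ^ (v + 2) * w n + 2 * (w 0 ^ (v + 2) * w n) + 4 * (w 0 ^ (v + 2) * w n)) := by
    intro n
    have hwn := hpos n
    have hwn1 := hpos (n + 1)
    have hwn2 := hpos (n + 2)
    have hw0 := hpos 0
    have hn : (0 : ℝ) ≤ n := Nat.cast_nonneg n
    have h1 : ((n : ℝ) + 1) ^ 2 / ((n : ℝ) + 2) ^ 2 ≤ 1 := by
      rw [div_le_one (by positivity)]; nlinarith [hn]
    have h2 : ((n : ℝ) + 1) * ((n : ℝ) + 3) / ((n : ℝ) + 2) ^ 2 ≤ 1 := by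
      rw [div_le_one (by positivity)]; nlinarith [hn]
    have h3 : ((n : ℝ) + 2) ^ 2 / ((n : ℝ) + 1) ^ 2 ≤ 4 := by
      rw [div_le_iff₀ (by positivity)]; nlinarith [hn]
    have hn0 : w n ≤ w 0 := hanti (Nat.zero_le _)
    have hn10 : w (n + 1) ≤ w 0 := hanti (Nat.zero_le _)
    have hn20 : w (n + 2) ≤ w 0 := hanti (Nat.zero_le _)
    have hp1 : w (n + 1) ^ (v + 1) ≤ w 0 ^ (v + 1) := pow_le_pow_left₀ hwn1.le hn10 _
    have hpn : w n ^ (v + 1) ≤ w 0 ^ (v + 1) := pow_le_pow_left₀ hwn.le hn0 _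
    have hA : w n ^ 2 * w (n + 1) ^ (v + 1) * (((n : ℝ) + 1) ^ 2 / ((n : ℝ) + 2) ^ 2) ≤ w 0 ^ (v + 2) * w n := by
      calc _ ≤ w n ^ 2 * w (n + 1) ^ (v + 1) * 1 := mul_le_mul_of_nonneg_left h1 (by positivity)
        _ = w n * (w n * w (n + 1) ^ (v + 1)) := by ring
        _ ≤ w n * (w 0 * w 0 ^ (v + 1)) :=
            mul_le_mul_of_nonneg_left (mul_le_mul hn0 hp1 (by positivity) hw0.le) hwn.le
        _ = w 0 ^ (v + 2) * w n := by ring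
    have hB : 2 * (w n * w (n + 2) * w (n + 1) ^ (v + 1)) * (((n : ℝ) + 1) * ((n : ℝ) + 3) / ((n : ℝ) + 2) ^ 2) ≤
        2 * (w 0 ^ (v + 2) * w n) := by
      calc _ ≤ 2 * (w n * w (n + 2) * w (n + 1) ^ (v + 1)) * 1 := mul_le_mul_of_nonneg_left h2 (by positivity)
        _ = 2 * (w n * (w (n + 2) * w (n + 1) ^ (v + 1))) := by ring
        _ ≤ 2 * (w n * (w 0 * w 0 ^ (v + 1))) := by
            refine mul_le_mul_of_nonneg_left (mul_le_mul_of_nonneg_left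
              (mul_le_mul hn20 hp1 (by positivity) hw0.le) hwn.le) (by norm_num)
        _ = 2 * (w 0 ^ (v + 2) * w n) := by ring
    have hC : w (n + 1) ^ 2 * w n ^ (v + 1) * (((n : ℝ) + 2) ^ 2 / ((n : ℝ) + 1) ^ 2) ≤ 4 * (w 0 ^ (v + 2) * w n) := by
      calc _ ≤ w (n + 1) ^ 2 * w n ^ (v + 1) * 4 := mul_le_mul_of_nonneg_left h3 (by positivity)
        _ = 4 * (w n * (w (n + 1) ^ 2 * w n ^ v)) := by ring
        _ ≤ 4 * (w n * (w 0 ^ 2 * w 0 ^ v)) := by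
            refine mul_le_mul_of_nonneg_left (mul_le_mul_of_nonneg_left (mul_le_mul
              (pow_le_pow_left₀ hwn1.le hn10 2) (pow_le_pow_left₀ hwn.le hn0 v) (by positivity)
              (by positivity)) hwn.le) (by norm_num)
        _ = 4 * (w 0 ^ (v + 2) * w n) := by ring
    linarith
  refine Summable.of_nonneg_of_le (fun n => ?_) hb ?_
  · have := (hpos n).le; have := (hpos (n + 1)).le; have := (hpos (n + 2)).le
    positivity
  · exact (((hsum.mul_left _).add ((hsum.mul_left _).mul_left 2)).add ((hsum.mul_left _).mul_left 4)).mul_left _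

omit hsum in
/-- The tail terms of `N − r²Z` in `abs_div_tsum_pair_sub_le`: each has modulus at most `(21/16) w_1^{v+2} w_{n+1}`. -/
theorem abs_pairTailTerm_le (v n : ℕ) :
    |(1 / 4 : ℝ) * (w (n + 1) ^ 2 * w (n + 1 + 1) ^ (v + 1) *
        ((((n + 1 : ℕ) : ℝ) + 1) ^ 2 / (((n + 1 : ℕ) : ℝ) + 2) ^ 2) +
      2 * (w (n + 1) * w (n + 1 + 2) * w (n + 1 + 1) ^ (v + 1)) *
        ((((n + 1 : ℕ) : ℝ) + 1) * (((n + 1 : ℕ) : ℝ) + 3) / (((n + 1 : ℕ) : ℝ) + 2) ^ 2) +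
      w (n + 1 + 1) ^ 2 * w (n + 1) ^ (v + 1) * ((((n + 1 : ℕ) : ℝ) + 2) ^ 2 / (((n + 1 : ℕ) : ℝ) + 1) ^ 2)) -
      (w 1 / w 0) ^ 2 * w (n + 1) ^ (v + 3)| ≤ 21 / 16 * (w 1 ^ (v + 2) * w (n + 1)) := by
  have hw0 := hpos 0
  have hw1 := hpos 1
  have hr0 : 0 ≤ w 1 / w 0 := by positivity
  have hr1 : w 1 / w 0 ≤ 1 := (div_le_one hw0).mpr (hanti (by norm_num))
  have hr2le : (w 1 / w 0) ^ 2 ≤ 1 := pow_le_one₀ hr0 hr1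
  have hwn1 := hpos (n + 1)
  have hwn2 := hpos (n + 1 + 1)
  have hwn3 := hpos (n + 1 + 2)
  have hn : (0 : ℝ) ≤ n := Nat.cast_nonneg n
  have h1 : (((n + 1 : ℕ) : ℝ) + 1) ^ 2 / (((n + 1 : ℕ) : ℝ) + 2) ^ 2 ≤ 1 := by
    rw [div_le_one (by positivity)]; push_cast; nlinarith [hn]
  have h2 : (((n + 1 : ℕ) : ℝ) + 1) * (((n + 1 : ℕ) : ℝ) + 3) / (((n + 1 : ℕ) : ℝ) + 2) ^ 2 ≤ 1 := by
    rw [div_le_one (by positivity)]; push_cast; nlinarith [hn]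
  have h3 : (((n + 1 : ℕ) : ℝ) + 2) ^ 2 / (((n + 1 : ℕ) : ℝ) + 1) ^ 2 ≤ 9 / 4 := by
    rw [div_le_iff₀ (by positivity)]; push_cast; nlinarith [hn]
  -- the three products and the subtracted term are each at most `c · w_1^{v+2} w_{n+1}`
  have hP1 : w (n + 1) ^ 2 * w (n + 1 + 1) ^ (v + 1) ≤ w 1 ^ (v + 2) * w (n + 1) := by
    have h := pow_mul_pow_le_of_antitone hanti hpos (m := n + 1) (k := n + 1 + 1) (by omega) (by omega) 1 v
    simpa [show 1 + v + 1 = v + 2 by omega] using h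
  have hP2 : w (n + 1) * w (n + 1 + 2) * w (n + 1 + 1) ^ (v + 1) ≤ w 1 ^ (v + 2) * w (n + 1) := by
    have hq1 : w (n + 1 + 2) ≤ w 1 := hanti (by omega)
    have hq2 : w (n + 1 + 1) ^ (v + 1) ≤ w 1 ^ (v + 1) := pow_le_pow_left₀ hwn2.le (hanti (by omega)) _
    calc w (n + 1) * w (n + 1 + 2) * w (n + 1 + 1) ^ (v + 1) = w (n + 1) * (w (n + 1 + 2) * w (n + 1 + 1) ^ (v + 1)) := by
          ring
      _ ≤ w (n + 1) * (w 1 * w 1 ^ (v + 1)) :=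
          mul_le_mul_of_nonneg_left (mul_le_mul hq1 hq2 (by positivity) hw1.le) hwn1.le
      _ = w 1 ^ (v + 2) * w (n + 1) := by ring
  have hP3 : w (n + 1 + 1) ^ 2 * w (n + 1) ^ (v + 1) ≤ w 1 ^ (v + 2) * w (n + 1) := by
    have h := pow_mul_pow_le_of_antitone hanti hpos (m := n + 1) (k := n + 1 + 1) (by omega) (by omega) v 1
    rw [mul_comm]
    simpa [show v + 1 + 1 = v + 2 by omega] using h
  have hP4 : (w 1 / w 0) ^ 2 * w (n + 1) ^ (v + 3) ≤ w 1 ^ (v + 2) * w (n + 1) := by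
    have hq : w (n + 1) ^ (v + 2) ≤ w 1 ^ (v + 2) := pow_le_pow_left₀ hwn1.le (hanti (by omega)) _
    calc (w 1 / w 0) ^ 2 * w (n + 1) ^ (v + 3) ≤ 1 * w (n + 1) ^ (v + 3) :=
          mul_le_mul_of_nonneg_right hr2le (by positivity)
      _ = w (n + 1) ^ (v + 2) * w (n + 1) := by rw [one_mul, pow_succ]
      _ ≤ w 1 ^ (v + 2) * w (n + 1) := mul_le_mul_of_nonneg_right hq hwn1.le
  have hA' : w (n + 1) ^ 2 * w (n + 1 + 1) ^ (v + 1) *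
      ((((n + 1 : ℕ) : ℝ) + 1) ^ 2 / (((n + 1 : ℕ) : ℝ) + 2) ^ 2) ≤ w 1 ^ (v + 2) * w (n + 1) := by
    calc _ ≤ w (n + 1) ^ 2 * w (n + 1 + 1) ^ (v + 1) * 1 := mul_le_mul_of_nonneg_left h1 (by positivity)
      _ ≤ w 1 ^ (v + 2) * w (n + 1) := by rw [mul_one]; exact hP1
  have hB' : 2 * (w (n + 1) * w (n + 1 + 2) * w (n + 1 + 1) ^ (v + 1)) *
      ((((n + 1 : ℕ) : ℝ) + 1) * (((n + 1 : ℕ) : ℝ) + 3) / (((n + 1 : ℕ) : ℝ) + 2) ^ 2) ≤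
      2 * (w 1 ^ (v + 2) * w (n + 1)) := by
    calc _ ≤ 2 * (w (n + 1) * w (n + 1 + 2) * w (n + 1 + 1) ^ (v + 1)) * 1 :=
          mul_le_mul_of_nonneg_left h2 (by positivity)
      _ ≤ 2 * (w 1 ^ (v + 2) * w (n + 1)) := by
          rw [mul_one]; exact mul_le_mul_of_nonneg_left hP2 (by norm_num)
  have hC' : w (n + 1 + 1) ^ 2 * w (n + 1) ^ (v + 1) *
      ((((n + 1 : ℕ) : ℝ) + 2) ^ 2 / (((n + 1 : ℕ) : ℝ) + 1) ^ 2) ≤ 9 / 4 * (w 1 ^ (v + 2) * w (n + 1)) := by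
    calc _ ≤ w (n + 1 + 1) ^ 2 * w (n + 1) ^ (v + 1) * (9 / 4) := mul_le_mul_of_nonneg_left h3 (by positivity)
      _ ≤ w 1 ^ (v + 2) * w (n + 1) * (9 / 4) := mul_le_mul_of_nonneg_right hP3 (by norm_num)
      _ = 9 / 4 * (w 1 ^ (v + 2) * w (n + 1)) := by ring
  have hA : 0 ≤ w (n + 1) ^ 2 * w (n + 1 + 1) ^ (v + 1) *
      ((((n + 1 : ℕ) : ℝ) + 1) ^ 2 / (((n + 1 : ℕ) : ℝ) + 2) ^ 2) := by positivity
  have hB : 0 ≤ 2 * (w (n + 1) * w (n + 1 + 2) * w (n + 1 + 1) ^ (v + 1)) *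
      ((((n + 1 : ℕ) : ℝ) + 1) * (((n + 1 : ℕ) : ℝ) + 3) / (((n + 1 : ℕ) : ℝ) + 2) ^ 2) := by positivity
  have hC : 0 ≤ w (n + 1 + 1) ^ 2 * w (n + 1) ^ (v + 1) *
      ((((n + 1 : ℕ) : ℝ) + 2) ^ 2 / (((n + 1 : ℕ) : ℝ) + 1) ^ 2) := by positivity
  have hE : 0 ≤ (w 1 / w 0) ^ 2 * w (n + 1) ^ (v + 3) := by positivity
  rw [abs_le]
  constructor <;> linarith

/-- **The abstract pair estimate.**  For an antitone, positive, summable `w : ℕ → ℝ` and `v : ℕ`: with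
`Z = Σ_n w_n^{v+3}`, `N = ¼ Σ_n [w_n² w_{n+1}^{v+1} ((n+1)/(n+2))² + 2 w_n w_{n+2} w_{n+1}^{v+1} (n+1)(n+3)/(n+2)²
+ w_{n+1}² w_n^{v+1} ((n+2)/(n+1))²]` and `r = w_1/w_0`: `|N/Z − r²| ≤ r^{v+1} (7/16 + (21/16)(Σ_n w_{n+1})/w_0)`.
(The `n = 0` term of `N − r²Z` is `(1/16) w_0² w_1^{v+1} + (3/8) w_0 w_2 w_1^{v+1} ≤ (7/16) w_0² w_1^{v+1}`; each further
term has modulus at most `(21/16) w_1^{v+2} w_n`.) -/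
theorem abs_div_tsum_pair_sub_le (v : ℕ) :
    |(∑' n : ℕ, (1 / 4 : ℝ) * (w n ^ 2 * w (n + 1) ^ (v + 1) * (((n : ℝ) + 1) ^ 2 / ((n : ℝ) + 2) ^ 2) +
        2 * (w n * w (n + 2) * w (n + 1) ^ (v + 1)) * (((n : ℝ) + 1) * ((n : ℝ) + 3) / ((n : ℝ) + 2) ^ 2) +
        w (n + 1) ^ 2 * w n ^ (v + 1) * (((n : ℝ) + 2) ^ 2 / ((n : ℝ) + 1) ^ 2))) /
        (∑' n : ℕ, w n ^ (v + 3)) - (w 1 / w 0) ^ 2| ≤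
      (w 1 / w 0) ^ (v + 1) * (7 / 16 + 21 / 16 * (∑' n : ℕ, w (n + 1)) / w 0) := by
  set N : ℝ := ∑' n : ℕ, (1 / 4 : ℝ) * (w n ^ 2 * w (n + 1) ^ (v + 1) * (((n : ℝ) + 1) ^ 2 / ((n : ℝ) + 2) ^ 2) +
    2 * (w n * w (n + 2) * w (n + 1) ^ (v + 1)) * (((n : ℝ) + 1) * ((n : ℝ) + 3) / ((n : ℝ) + 2) ^ 2) +
    w (n + 1) ^ 2 * w n ^ (v + 1) * (((n : ℝ) + 2) ^ 2 / ((n : ℝ) + 1) ^ 2)) with hN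
  set Z : ℝ := ∑' n : ℕ, w n ^ (v + 3) with hZ
  set S : ℝ := ∑' n : ℕ, w (n + 1) with hS
  set r : ℝ := w 1 / w 0 with hr
  have hw0 := hpos 0
  have hw1 := hpos 1
  have hw2 := hpos 2
  have hS0 : 0 ≤ S := tsum_nonneg fun n => (hpos _).le
  have hr0 : 0 ≤ r := by positivity
  have hr1 : r ≤ 1 := (div_le_one hw0).mpr (hanti (by norm_num))
  have hsumZ : Summable fun n => w n ^ (v + 3) := summable_pow_of_antitone hanti hpos hsum _ (by omega)
  have hsumN := summable_pairNumTerm hanti hpos hsum v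
  have hsumS : Summable fun n => w (n + 1) := (summable_nat_add_iff 1).mpr hsum
  have hZge : w 0 ^ (v + 3) ≤ Z := hsumZ.le_tsum 0 (fun j _ => pow_nonneg (hpos j).le _)
  have hZpos : 0 < Z := lt_of_lt_of_le (pow_pos hw0 _) hZge
  have hr2le : r ^ 2 ≤ 1 := pow_le_one₀ hr0 hr1
  -- the difference as one series
  set D : ℕ → ℝ := fun n => (1 / 4 : ℝ) * (w n ^ 2 * w (n + 1) ^ (v + 1) * (((n : ℝ) + 1) ^ 2 / ((n : ℝ) + 2) ^ 2) +
    2 * (w n * w (n + 2) * w (n + 1) ^ (v + 1)) * (((n : ℝ) + 1) * ((n : ℝ) + 3) / ((n : ℝ) + 2) ^ 2) +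
    w (n + 1) ^ 2 * w n ^ (v + 1) * (((n : ℝ) + 2) ^ 2 / ((n : ℝ) + 1) ^ 2)) - r ^ 2 * w n ^ (v + 3) with hD
  have hsumD : Summable D := hsumN.sub (hsumZ.mul_left _)
  have hdiff : N - r ^ 2 * Z = ∑' n, D n := by
    rw [hN, hZ, ← tsum_mul_left, ← hsumN.tsum_sub (hsumZ.mul_left _)]
  have hD0 : D 0 = 1 / 16 * (w 0 ^ 2 * w 1 ^ (v + 1)) + 3 / 8 * (w 0 * w 2 * w 1 ^ (v + 1)) := by
    rw [hD, hr]
    simp only [Nat.cast_zero, zero_add]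
    have hw00 : w 0 ≠ 0 := hw0.ne'
    rw [div_pow]
    field_simp
    ring
  have hD0le : |D 0| ≤ 7 / 16 * (w 1 ^ (v + 1) * w 0 ^ 2) := by
    rw [hD0, abs_of_nonneg (by positivity)]
    have h2 : w 2 ≤ w 0 := hanti (by norm_num)
    have : w 0 * w 2 * w 1 ^ (v + 1) ≤ w 0 * w 0 * w 1 ^ (v + 1) :=
      mul_le_mul_of_nonneg_right (mul_le_mul_of_nonneg_left h2 hw0.le) (by positivity)
    nlinarith
  have hDtail : ∀ n, |D (n + 1)| ≤ 21 / 16 * (w 1 ^ (v + 2) * w (n + 1)) := by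
    intro n
    rw [hD, hr]
    exact abs_pairTailTerm_le hanti hpos v n
  -- `|N − r²Z| ≤ (7/16) w_1^{v+1} w_0² + (21/16) w_1^{v+2} S`
  have hsumDtail : Summable fun n => D (n + 1) := (summable_nat_add_iff 1).mpr hsumD
  have habs : |N - r ^ 2 * Z| ≤ 7 / 16 * (w 1 ^ (v + 1) * w 0 ^ 2) + 21 / 16 * (w 1 ^ (v + 2) * S) := by
    rw [hdiff, hsumD.tsum_eq_zero_add]
    have htail : |∑' n, D (n + 1)| ≤ ∑' n, 21 / 16 * (w 1 ^ (v + 2) * w (n + 1)) := by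
      have h1 : ‖∑' n, D (n + 1)‖ ≤ ∑' n, ‖D (n + 1)‖ := norm_tsum_le_tsum_norm hsumDtail.norm
      simp only [Real.norm_eq_abs] at h1
      exact h1.trans (hsumDtail.abs.tsum_le_tsum hDtail ((hsumS.mul_left _).mul_left _))
    rw [tsum_mul_left, tsum_mul_left, ← hS] at htail
    calc |D 0 + ∑' n, D (n + 1)| ≤ |D 0| + |∑' n, D (n + 1)| := abs_add_le _ _
      _ ≤ _ := add_le_add hD0le htail
  -- divide by `Z ≥ w_0^{v+3}`
  have hZ0 : Z ≠ 0 := hZpos.ne'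
  have hw00 : w 0 ≠ 0 := hw0.ne'
  have hkey : N / Z - r ^ 2 = (N - r ^ 2 * Z) / Z := by field_simp
  rw [hkey, abs_div, abs_of_pos hZpos, div_le_iff₀ hZpos]
  have hK : 0 ≤ r ^ (v + 1) * (7 / 16 + 21 / 16 * S / w 0) := by
    have : 0 ≤ 21 / 16 * S / w 0 := by positivity
    positivity
  have hw1e : w 1 ^ (v + 1) = r ^ (v + 1) * w 0 ^ (v + 1) := by
    rw [hr, div_pow, div_mul_cancel₀]
    positivity
  have hw1e' : w 1 ^ (v + 2) = r ^ (v + 2) * w 0 ^ (v + 2) := by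
    rw [hr, div_pow, div_mul_cancel₀]
    positivity
  have hrr : r ^ (v + 2) ≤ r ^ (v + 1) := pow_le_pow_of_le_one hr0 hr1 (by omega)
  calc |N - r ^ 2 * Z| ≤ 7 / 16 * (w 1 ^ (v + 1) * w 0 ^ 2) + 21 / 16 * (w 1 ^ (v + 2) * S) := habs
    _ = 7 / 16 * r ^ (v + 1) * w 0 ^ (v + 3) + 21 / 16 * (r ^ (v + 2) * S / w 0) * w 0 ^ (v + 3) := by
        rw [hw1e, hw1e']
        field_simp
        ring
    _ ≤ 7 / 16 * r ^ (v + 1) * w 0 ^ (v + 3) + 21 / 16 * (r ^ (v + 1) * S / w 0) * w 0 ^ (v + 3) := by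
        have h1 : r ^ (v + 2) * S / w 0 ≤ r ^ (v + 1) * S / w 0 :=
          div_le_div_of_nonneg_right (mul_le_mul_of_nonneg_right hrr hS0) hw0.le
        have h2 := mul_le_mul_of_nonneg_right h1 (pow_pos hw0 (v + 3)).le
        linarith
    _ = r ^ (v + 1) * (7 / 16 + 21 / 16 * S / w 0) * w 0 ^ (v + 3) := by ring
    _ ≤ r ^ (v + 1) * (7 / 16 + 21 / 16 * S / w 0) * Z := mul_le_mul_of_nonneg_left hZge hK

end Abstract

end Summit.Ventures.LatticeQCDFlow.Scoring
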